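import Summits.AnomalousDissipation.AnomalousDissipation.Theorems.SawtoothPulseCascadeK1LocalisedCascadeKHModeSource
import Summits.AnomalousDissipation.AnomalousDissipation.Theorems.SawtoothPulseCascadeK1LocalisedCascadeKHCombAmplitude

/-!
# K2 lane (route-2 `SawtoothPulseCascade`, crux dir `K1LocalisedCascade`): the SHARP single-mode creation law — `≤ 0.889/a` uniformly in the mode

Helper file of the K2 lane (ACL item stmt-AnomalousDissipation-19491; E6/E1 of the S4 line, arbiter A26-13 (3a) / A27-1 (iii) «P2-E6»). Combines the
two-envelope source bound of `…KHModeSource` (mode `ξ`, envelopes `1/√(1+(ξ/a ± s)²)`, weights `N₊ ≥ N₋`) with the block data of `…KHCombAmplitude`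
(purely imaginary diagonal, `ω ≤ a·p`, ratio `≤ 1 + 2·10⁻⁵` at `a ≥ 4`) through an abstract Duhamel bound with an ARBITRARY continuous envelope
(`norm_duhamel_env_le`): the created amplitude of the single mode `e^{2πiξy}` is at most `4πa(a·p+2a|S|)/ω · (N₊I₊ + N₋I₋)/((1−q)2κ·κ)` with the
envelope integrals `I₊ = arsinh(ξ/a+θ) − arsinh(ξ/a)`, `I₋ = arsinh(ξ/a) − arsinh(ξ/a−θ)` (`integral_inv_sqrt_one_add_sq_shift`), and since
`I₊ + I₋ = arsinh(ξ/a+θ) − arsinh(ξ/a−θ) ≤ 2 arsinh θ` (`arsinh_window_le`: the mode `ξ = 0` is the worst one) the NUMBER follows: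
**`≤ 0.889/a` for every mode `ξ`, every Bloch phase, `a ≥ 4`, `0 ≤ θ ≤ 8`** (`mode_creation_num_le`, `mode_creation_num_le'`) — against `8.5/a` of
`…KHSingleModeCreation` (uniform IBP). Modes with `|ξ/a| > θ` never un-tilt inside the slot: their envelope integral is `arsinh(u+θ) − arsinh(u−θ) = O(θ/u)`
(`mode_component_le` keeps the `ξ`-dependence for the far-block sums of E6). No definitions; no statement about the crux.
[cite: Drazin2002, §8.3 (8.36)–(8.38)] [problem: turb]
-/

-- `Summit.<Summit>.<Problem>`: single-conjunct summit, the duplicate namespace segment is deliberate.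
set_option linter.dupNamespace false

noncomputable section

namespace Summit.AnomalousDissipation.AnomalousDissipation.Theorems.SawtoothPulseCascade.K2PhaseBudget

open Set MeasureTheory intervalIntegral Literature.Analysis.FluidPDE.SawtoothCascade

/-! ## §1 Shifted envelope integrals and the `arsinh` window inequality -/

/-- `√(1+(s+c)²) ≠ 0`. [folklore] -/
theorem sqrt_one_add_sq_shift_ne_zero (c s : ℝ) : Real.sqrt (1 + (s + c) ^ 2) ≠ 0 := (Real.sqrt_pos.2 (by positivity)).ne'

/-- The shifted envelope is continuous. [folklore] -/
theorem continuous_inv_sqrt_one_add_sq_shift (c : ℝ) : Continuous fun s : ℝ => (Real.sqrt (1 + (s + c) ^ 2))⁻¹ :=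
  Continuous.inv₀ (by fun_prop) (sqrt_one_add_sq_shift_ne_zero c)

/-- `∫₀^θ ds/√(1+(s+c)²) = arsinh(θ+c) − arsinh(c)`. [folklore] -/
theorem integral_inv_sqrt_one_add_sq_shift (c θ : ℝ) :
    ∫ s in (0 : ℝ)..θ, (Real.sqrt (1 + (s + c) ^ 2))⁻¹ = Real.arsinh (θ + c) - Real.arsinh c := by
  have hd : ∀ s : ℝ, HasDerivAt (fun s : ℝ => Real.arsinh (s + c)) ((Real.sqrt (1 + (s + c) ^ 2))⁻¹) s := by
    intro s
    have h := ((hasDerivAt_id s).add_const c).arsinh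
    simpa using h
  have h := intervalIntegral.integral_eq_sub_of_hasDerivAt (a := 0) (b := θ) (fun s _ => hd s)
    ((continuous_inv_sqrt_one_add_sq_shift c).intervalIntegrable _ _)
  rw [h]; simp

/-- **The `arsinh` window inequality:** `arsinh(u+θ) − arsinh(u−θ) ≤ 2·arsinh θ` for `θ ≥ 0` (the window of width `2θ` collects most `arsinh`-mass
when centred at `0`: the mode `ξ = 0` is the worst single mode). [folklore] -/
theorem arsinh_window_le {θ : ℝ} (hθ : 0 ≤ θ) (u : ℝ) : Real.arsinh (u + θ) - Real.arsinh (u - θ) ≤ 2 * Real.arsinh θ := by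
  -- the even function `h(u) = arsinh(u+θ) − arsinh(u−θ)` is antitone on `[0, ∞)`
  have key : ∀ v : ℝ, 0 ≤ v → Real.arsinh (v + θ) - Real.arsinh (v - θ) ≤ 2 * Real.arsinh θ := by
    intro v hv
    have hderiv : ∀ x : ℝ, HasDerivAt (fun x : ℝ => Real.arsinh (x + θ) - Real.arsinh (x - θ))
        ((Real.sqrt (1 + (x + θ) ^ 2))⁻¹ - (Real.sqrt (1 + (x - θ) ^ 2))⁻¹) x := by
      intro x
      have h1 := ((hasDerivAt_id x).add_const θ).arsinh
      have h2 := ((hasDerivAt_id x).sub_const θ).arsinh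
      have h := h1.sub h2
      simp only [id, smul_eq_mul, mul_one] at h
      refine (h.congr_of_eventuallyEq ?_)
      exact Filter.Eventually.of_forall fun y => by simp [Pi.sub_apply]
    have hanti : AntitoneOn (fun x : ℝ => Real.arsinh (x + θ) - Real.arsinh (x - θ)) (Set.Ici 0) := by
      apply antitoneOn_of_deriv_nonpos (convex_Ici 0)
      · exact HasDerivAt.continuousOn fun x _ => hderiv x
      · intro x _; exact (hderiv x).differentiableAt.differentiableWithinAt
      · intro x hx
        rw [interior_Ici] at hx
        rw [(hderiv x).deriv]
        have hx0 : 0 < x := hx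
        have hle : Real.sqrt (1 + (x - θ) ^ 2) ≤ Real.sqrt (1 + (x + θ) ^ 2) := Real.sqrt_le_sqrt (by nlinarith)
        have hpos : 0 < Real.sqrt (1 + (x - θ) ^ 2) := Real.sqrt_pos.2 (by positivity)
        have := inv_anti₀ hpos hle
        linarith
    have h0 : Real.arsinh (0 + θ) - Real.arsinh (0 - θ) = 2 * Real.arsinh θ := by
      rw [zero_add, zero_sub, Real.arsinh_neg]; ring
    rw [← h0]
    exact hanti (Set.mem_Ici.2 le_rfl) (Set.mem_Ici.2 hv) hv
  rcases le_or_gt 0 u with hu | hu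
  · exact key u hu
  · have h := key (-u) (by linarith)
    have e1 : Real.arsinh (-u + θ) = -Real.arsinh (u - θ) := by rw [← Real.arsinh_neg]; congr 1; ring
    have e2 : Real.arsinh (-u - θ) = -Real.arsinh (u + θ) := by rw [← Real.arsinh_neg]; congr 1; ring
    rw [e1, e2] at h
    linarith

/-! ## §2 Duhamel bound with an arbitrary envelope -/

/-- **Duhamel bound, arbitrary envelope (main term first).** Stable row with purely imaginary `x₀`, `‖x₀‖ ≥ ω > 0`; sources bounded pointwise by a
continuous envelope `env`: amplitude `≤ (‖x₀‖‖c₀‖ + ‖x₁‖‖c₁‖)/ω · ∫₀^θ env`. [folklore] -/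
theorem norm_duhamel_env_le {θ ω : ℝ} {x₀ x₁ c₀ c₁ : ℂ} {S₀ S₁ : ℝ → ℂ} {env : ℝ → ℝ} (hθ : 0 ≤ θ) (hω : 0 < ω) (hx₀ : x₀.re = 0)
    (hωx : ω ≤ ‖x₀‖) (henv : Continuous env) (hE₀ : ∀ s, ‖S₀ s‖ ≤ env s) (hE₁ : ∀ s, ‖S₁ s‖ ≤ env s) :
    ‖∫ s in (0 : ℝ)..θ, ((Real.cos (ω * (θ - s)) : ℂ) * (c₀ * S₀ s) +
        ((Real.sin (ω * (θ - s)) / ω : ℝ) : ℂ) * (x₀ * (c₀ * S₀ s) + x₁ * (c₁ * S₁ s)))‖ ≤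
      (‖x₀‖ * ‖c₀‖ + ‖x₁‖ * ‖c₁‖) / ω * ∫ s in (0 : ℝ)..θ, env s := by
  have hg : IntervalIntegrable (fun s : ℝ => (‖x₀‖ * ‖c₀‖ + ‖x₁‖ * ‖c₁‖) / ω * env s) volume 0 θ :=
    (continuous_const.mul henv).intervalIntegrable _ _
  have hpt : ∀ᵐ s : ℝ ∂volume, s ∈ Set.Ioc (0 : ℝ) θ →
      ‖(Real.cos (ω * (θ - s)) : ℂ) * (c₀ * S₀ s) + ((Real.sin (ω * (θ - s)) / ω : ℝ) : ℂ) * (x₀ * (c₀ * S₀ s) + x₁ * (c₁ * S₁ s))‖ ≤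
        (‖x₀‖ * ‖c₀‖ + ‖x₁‖ * ‖c₁‖) / ω * env s := by
    refine Filter.Eventually.of_forall fun s _ => ?_
    refine (norm_duhamel_integrand_le hx₀ hω hωx _).trans ?_
    rw [div_mul_eq_mul_div, add_mul]
    apply div_le_div_of_nonneg_right _ hω.le
    have h0 := hE₀ s
    have h1 := hE₁ s
    have := mul_le_mul_of_nonneg_left h0 (mul_nonneg (norm_nonneg x₀) (norm_nonneg c₀))
    have := mul_le_mul_of_nonneg_left h1 (mul_nonneg (norm_nonneg x₁) (norm_nonneg c₁))
    linarith
  have h := intervalIntegral.norm_integral_le_of_norm_le hθ hpt hg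
  rw [intervalIntegral.integral_const_mul] at h
  exact h

/-- **Duhamel bound, arbitrary envelope (main term second).** [folklore] -/
theorem norm_duhamel_env_le' {θ ω : ℝ} {x₀ x₁ c₀ c₁ : ℂ} {S₀ S₁ : ℝ → ℂ} {env : ℝ → ℝ} (hθ : 0 ≤ θ) (hω : 0 < ω) (hx₁ : x₁.re = 0)
    (hωx : ω ≤ ‖x₁‖) (henv : Continuous env) (hE₀ : ∀ s, ‖S₀ s‖ ≤ env s) (hE₁ : ∀ s, ‖S₁ s‖ ≤ env s) :
    ‖∫ s in (0 : ℝ)..θ, ((Real.cos (ω * (θ - s)) : ℂ) * (c₁ * S₁ s) +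
        ((Real.sin (ω * (θ - s)) / ω : ℝ) : ℂ) * (x₀ * (c₀ * S₀ s) + x₁ * (c₁ * S₁ s)))‖ ≤
      (‖x₁‖ * ‖c₁‖ + ‖x₀‖ * ‖c₀‖) / ω * ∫ s in (0 : ℝ)..θ, env s := by
  have e : (∫ s in (0 : ℝ)..θ, ((Real.cos (ω * (θ - s)) : ℂ) * (c₁ * S₁ s) +
        ((Real.sin (ω * (θ - s)) / ω : ℝ) : ℂ) * (x₀ * (c₀ * S₀ s) + x₁ * (c₁ * S₁ s)))) =
      ∫ s in (0 : ℝ)..θ, ((Real.cos (ω * (θ - s)) : ℂ) * (c₁ * S₁ s) +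
        ((Real.sin (ω * (θ - s)) / ω : ℝ) : ℂ) * (x₁ * (c₁ * S₁ s) + x₀ * (c₀ * S₀ s))) :=
    intervalIntegral.integral_congr fun s _ => by simp only [add_comm]
  rw [e]
  exact norm_duhamel_env_le hθ hω hx₁ hωx henv hE₁ hE₀

/-! ## §3 The single mode `ξ`: envelope integral and the number -/

section mode

variable {a β θ ξ : ℝ} {G0 Gh : ℂ} {S₀ S₁ : ℝ → ℂ}

/-- The two-envelope function of `…KHModeSource` is continuous and integrates to `(N₊I₊ + N₋I₋)/((1−q)2κ·κ)`,
`I₊ = arsinh(ξ/a+θ) − arsinh(ξ/a)`, `I₋ = arsinh(ξ/a) − arsinh(ξ/a−θ)`. [folklore] -/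
theorem integral_mode_envelope (a ξ θ Np Nm D : ℝ) :
    ∫ s in (0 : ℝ)..θ, (Np / (D * ((2 * Real.pi * a) * Real.sqrt (1 + (ξ / a + 1 * s) ^ 2))) +
        Nm / (D * ((2 * Real.pi * a) * Real.sqrt (1 + (ξ / a + (-1) * s) ^ 2)))) =
      (Np * (Real.arsinh (ξ / a + θ) - Real.arsinh (ξ / a)) + Nm * (Real.arsinh (ξ / a) - Real.arsinh (ξ / a - θ))) /
        (D * (2 * Real.pi * a)) := by
  have e1 : ∀ s : ℝ, Real.sqrt (1 + (ξ / a + 1 * s) ^ 2) = Real.sqrt (1 + (s + ξ / a) ^ 2) := fun s => by ring_nf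
  have e2 : ∀ s : ℝ, Real.sqrt (1 + (ξ / a + (-1) * s) ^ 2) = Real.sqrt (1 + (s + (-(ξ / a))) ^ 2) := fun s => by ring_nf
  simp_rw [e1, e2]
  have hi1 := (continuous_inv_sqrt_one_add_sq_shift (ξ / a)).intervalIntegrable (μ := volume) 0 θ
  have hi2 := (continuous_inv_sqrt_one_add_sq_shift (-(ξ / a))).intervalIntegrable (μ := volume) 0 θ
  have f1 : ∀ s : ℝ, Np / (D * ((2 * Real.pi * a) * Real.sqrt (1 + (s + ξ / a) ^ 2))) =
      Np / (D * (2 * Real.pi * a)) * (Real.sqrt (1 + (s + ξ / a) ^ 2))⁻¹ := fun s => by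
    rw [div_eq_mul_inv, div_eq_mul_inv, mul_inv, mul_inv, mul_inv]; ring
  have f2 : ∀ s : ℝ, Nm / (D * ((2 * Real.pi * a) * Real.sqrt (1 + (s + -(ξ / a)) ^ 2))) =
      Nm / (D * (2 * Real.pi * a)) * (Real.sqrt (1 + (s + -(ξ / a)) ^ 2))⁻¹ := fun s => by
    rw [div_eq_mul_inv, div_eq_mul_inv, mul_inv, mul_inv, mul_inv]; ring
  simp_rw [f1, f2]
  rw [intervalIntegral.integral_add (hi1.const_mul _) (hi2.const_mul _), intervalIntegral.integral_const_mul,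
    intervalIntegral.integral_const_mul, integral_inv_sqrt_one_add_sq_shift, integral_inv_sqrt_one_add_sq_shift]
  have e3 : θ + -(ξ / a) = -(ξ / a - θ) := by ring
  rw [e3, Real.arsinh_neg, Real.arsinh_neg, show θ + ξ / a = ξ / a + θ by ring]
  field_simp
  ring

/-- **Single-mode creation at mode `ξ`, component `0` (symbolic, ξ-resolved):** amplitude
`≤ 4πa(a·p + 2a‖S‖)/ω · (N₊I₊ + N₋I₋)/((1−q)2κ·κ)` (`a ≥ 1`, `θ ≥ 0`, any `β`, `ξ`). [cite: Drazin2002, §8.3 (8.36)–(8.38)] -/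
theorem mode_component_le (ha : 1 ≤ a) (hθ : 0 ≤ θ) (h0 : (2 * Real.pi : ℂ) * G0 = ((sawSigma0 a β : ℝ) : ℂ))
    (hh : (2 * Real.pi : ℂ) * starRingEnd ℂ Gh = sawS a β)
    (hE₀ : ∀ s, ‖S₀ s‖ ≤ (1 + 2 * Real.exp (-(2 * Real.pi * a) / 4) + 2 * Real.exp (-(2 * Real.pi * a) / 4) ^ 2 +
        2 * Real.exp (-(2 * Real.pi * a) / 4) ^ 3 + Real.exp (-(2 * Real.pi * a) / 4) ^ 4) /
          (((1 - Real.exp (-(2 * Real.pi * a))) * (2 * (2 * Real.pi * a))) * ((2 * Real.pi * a) * Real.sqrt (1 + (ξ / a + 1 * s) ^ 2))) +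
        (1 + 2 * Real.exp (-(2 * Real.pi * a) / 4) ^ 2 + Real.exp (-(2 * Real.pi * a) / 4) ^ 4) /
          (((1 - Real.exp (-(2 * Real.pi * a))) * (2 * (2 * Real.pi * a))) * ((2 * Real.pi * a) * Real.sqrt (1 + (ξ / a + (-1) * s) ^ 2))))
    (hE₁ : ∀ s, ‖S₁ s‖ ≤ (1 + 2 * Real.exp (-(2 * Real.pi * a) / 4) + 2 * Real.exp (-(2 * Real.pi * a) / 4) ^ 2 +
        2 * Real.exp (-(2 * Real.pi * a) / 4) ^ 3 + Real.exp (-(2 * Real.pi * a) / 4) ^ 4) /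
          (((1 - Real.exp (-(2 * Real.pi * a))) * (2 * (2 * Real.pi * a))) * ((2 * Real.pi * a) * Real.sqrt (1 + (ξ / a + 1 * s) ^ 2))) +
        (1 + 2 * Real.exp (-(2 * Real.pi * a) / 4) ^ 2 + Real.exp (-(2 * Real.pi * a) / 4) ^ 4) /
          (((1 - Real.exp (-(2 * Real.pi * a))) * (2 * (2 * Real.pi * a))) * ((2 * Real.pi * a) * Real.sqrt (1 + (ξ / a + (-1) * s) ^ 2)))) :
    ‖∫ s in (0 : ℝ)..θ, ((Real.cos (a * Real.sqrt (max 0 (sawC2 a β)) * (θ - s)) : ℂ) *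
          ((((2 * Real.pi * a : ℝ) * Complex.I : ℂ) * (-2)) * S₀ s) +
        ((Real.sin (a * Real.sqrt (max 0 (sawC2 a β)) * (θ - s)) / (a * Real.sqrt (max 0 (sawC2 a β))) : ℝ) : ℂ) *
          ((((2 * Real.pi * a : ℝ) : ℂ) * Complex.I) * (-(1 / 4 : ℂ) - 2 * G0) * ((((2 * Real.pi * a : ℝ) * Complex.I : ℂ) * (-2)) * S₀ s) +
            (((2 * Real.pi * a : ℝ) : ℂ) * Complex.I) * (-2 * Gh) * ((((2 * Real.pi * a : ℝ) * Complex.I : ℂ) * 2) * S₁ s)))‖ ≤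
      4 * Real.pi * a * (a * (Real.pi / 2 + 2 * sawSigma0 a β) + 2 * a * ‖sawS a β‖) / (a * Real.sqrt (max 0 (sawC2 a β))) *
        (((1 + 2 * Real.exp (-(2 * Real.pi * a) / 4) + 2 * Real.exp (-(2 * Real.pi * a) / 4) ^ 2 + 2 * Real.exp (-(2 * Real.pi * a) / 4) ^ 3 +
            Real.exp (-(2 * Real.pi * a) / 4) ^ 4) * (Real.arsinh (ξ / a + θ) - Real.arsinh (ξ / a)) +
          (1 + 2 * Real.exp (-(2 * Real.pi * a) / 4) ^ 2 + Real.exp (-(2 * Real.pi * a) / 4) ^ 4) * (Real.arsinh (ξ / a) - Real.arsinh (ξ / a - θ))) /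
          (((1 - Real.exp (-(2 * Real.pi * a))) * (2 * (2 * Real.pi * a))) * (2 * Real.pi * a))) := by
  have ha0 : 0 < a := by linarith
  have hω0 : 0 < a * Real.sqrt (max 0 (sawC2 a β)) := by have := omega_ge ha β; linarith
  have hp := kh_p_nonneg ha β
  have hdiag := norm_blockX_diag_eq ha0 h0
  rw [abs_of_nonneg hp] at hdiag
  have hωx : a * Real.sqrt (max 0 (sawC2 a β)) ≤ ‖(((2 * Real.pi * a : ℝ) : ℂ) * Complex.I) * (-(1 / 4 : ℂ) - 2 * G0)‖ := by
    rw [hdiag, ← abs_of_nonneg hp]; exact omega_le_diag ha β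
  have hD : (1 - Real.exp (-(2 * Real.pi * a))) * (2 * (2 * Real.pi * a)) ≠ 0 := by
    have hq1 : Real.exp (-(2 * Real.pi * a)) < 1 := Real.exp_lt_one_iff.2 (by nlinarith [Real.pi_pos])
    have : 0 < 2 * (2 * Real.pi * a) := by positivity
    nlinarith
  have henv : Continuous fun s : ℝ => (1 + 2 * Real.exp (-(2 * Real.pi * a) / 4) + 2 * Real.exp (-(2 * Real.pi * a) / 4) ^ 2 +
        2 * Real.exp (-(2 * Real.pi * a) / 4) ^ 3 + Real.exp (-(2 * Real.pi * a) / 4) ^ 4) /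
          (((1 - Real.exp (-(2 * Real.pi * a))) * (2 * (2 * Real.pi * a))) * ((2 * Real.pi * a) * Real.sqrt (1 + (ξ / a + 1 * s) ^ 2))) +
        (1 + 2 * Real.exp (-(2 * Real.pi * a) / 4) ^ 2 + Real.exp (-(2 * Real.pi * a) / 4) ^ 4) /
          (((1 - Real.exp (-(2 * Real.pi * a))) * (2 * (2 * Real.pi * a))) * ((2 * Real.pi * a) * Real.sqrt (1 + (ξ / a + (-1) * s) ^ 2))) := by
    have h1 : ∀ s : ℝ, ((1 - Real.exp (-(2 * Real.pi * a))) * (2 * (2 * Real.pi * a))) * ((2 * Real.pi * a) * Real.sqrt (1 + (ξ / a + 1 * s) ^ 2)) ≠ 0 :=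
      fun s => mul_ne_zero hD (mul_ne_zero (by positivity) (Real.sqrt_pos.2 (by positivity)).ne')
    have h2 : ∀ s : ℝ, ((1 - Real.exp (-(2 * Real.pi * a))) * (2 * (2 * Real.pi * a))) * ((2 * Real.pi * a) * Real.sqrt (1 + (ξ / a + (-1) * s) ^ 2)) ≠ 0 :=
      fun s => mul_ne_zero hD (mul_ne_zero (by positivity) (Real.sqrt_pos.2 (by positivity)).ne')
    exact (Continuous.div continuous_const (by fun_prop) h1).add (Continuous.div continuous_const (by fun_prop) h2)
  have h := norm_duhamel_env_le (c₀ := ((2 * Real.pi * a : ℝ) * Complex.I : ℂ) * (-2)) (c₁ := ((2 * Real.pi * a : ℝ) * Complex.I : ℂ) * 2)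
    (x₁ := (((2 * Real.pi * a : ℝ) : ℂ) * Complex.I) * (-2 * Gh)) hθ hω0 (blockX_diag_re h0) hωx henv hE₀ hE₁
  rw [integral_mode_envelope] at h
  have hκ : 0 < 2 * Real.pi * a := by positivity
  have hc0 : ‖(((2 * Real.pi * a : ℝ) * Complex.I : ℂ) * (-2))‖ = 4 * Real.pi * a := by
    rw [norm_mul, norm_mul, Complex.norm_real, Complex.norm_I, Real.norm_eq_abs, abs_of_pos hκ, norm_neg]; simp; ring
  have hc1 : ‖(((2 * Real.pi * a : ℝ) * Complex.I : ℂ) * 2)‖ = 4 * Real.pi * a := by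
    rw [norm_mul, norm_mul, Complex.norm_real, Complex.norm_I, Real.norm_eq_abs, abs_of_pos hκ]; simp; ring
  rw [hc0, hc1, hdiag, norm_blockX_off_eq ha0 hh] at h
  refine h.trans (le_of_eq ?_)
  ring

/-- **Component `1` (symbolic, ξ-resolved).** [cite: Drazin2002, §8.3 (8.36)–(8.38)] -/
theorem mode_component_le' (ha : 1 ≤ a) (hθ : 0 ≤ θ) (h0 : (2 * Real.pi : ℂ) * G0 = ((sawSigma0 a β : ℝ) : ℂ))
    (hh : (2 * Real.pi : ℂ) * starRingEnd ℂ Gh = sawS a β)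
    (hE₀ : ∀ s, ‖S₀ s‖ ≤ (1 + 2 * Real.exp (-(2 * Real.pi * a) / 4) + 2 * Real.exp (-(2 * Real.pi * a) / 4) ^ 2 +
        2 * Real.exp (-(2 * Real.pi * a) / 4) ^ 3 + Real.exp (-(2 * Real.pi * a) / 4) ^ 4) /
          (((1 - Real.exp (-(2 * Real.pi * a))) * (2 * (2 * Real.pi * a))) * ((2 * Real.pi * a) * Real.sqrt (1 + (ξ / a + 1 * s) ^ 2))) +
        (1 + 2 * Real.exp (-(2 * Real.pi * a) / 4) ^ 2 + Real.exp (-(2 * Real.pi * a) / 4) ^ 4) /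
          (((1 - Real.exp (-(2 * Real.pi * a))) * (2 * (2 * Real.pi * a))) * ((2 * Real.pi * a) * Real.sqrt (1 + (ξ / a + (-1) * s) ^ 2))))
    (hE₁ : ∀ s, ‖S₁ s‖ ≤ (1 + 2 * Real.exp (-(2 * Real.pi * a) / 4) + 2 * Real.exp (-(2 * Real.pi * a) / 4) ^ 2 +
        2 * Real.exp (-(2 * Real.pi * a) / 4) ^ 3 + Real.exp (-(2 * Real.pi * a) / 4) ^ 4) /
          (((1 - Real.exp (-(2 * Real.pi * a))) * (2 * (2 * Real.pi * a))) * ((2 * Real.pi * a) * Real.sqrt (1 + (ξ / a + 1 * s) ^ 2))) +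
        (1 + 2 * Real.exp (-(2 * Real.pi * a) / 4) ^ 2 + Real.exp (-(2 * Real.pi * a) / 4) ^ 4) /
          (((1 - Real.exp (-(2 * Real.pi * a))) * (2 * (2 * Real.pi * a))) * ((2 * Real.pi * a) * Real.sqrt (1 + (ξ / a + (-1) * s) ^ 2)))) :
    ‖∫ s in (0 : ℝ)..θ, ((Real.cos (a * Real.sqrt (max 0 (sawC2 a β)) * (θ - s)) : ℂ) *
          ((((2 * Real.pi * a : ℝ) * Complex.I : ℂ) * 2) * S₁ s) +
        ((Real.sin (a * Real.sqrt (max 0 (sawC2 a β)) * (θ - s)) / (a * Real.sqrt (max 0 (sawC2 a β))) : ℝ) : ℂ) *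
          ((((2 * Real.pi * a : ℝ) : ℂ) * Complex.I) * (2 * starRingEnd ℂ Gh) * ((((2 * Real.pi * a : ℝ) * Complex.I : ℂ) * (-2)) * S₀ s) +
            (((2 * Real.pi * a : ℝ) : ℂ) * Complex.I) * ((1 / 4 : ℂ) + 2 * G0) * ((((2 * Real.pi * a : ℝ) * Complex.I : ℂ) * 2) * S₁ s)))‖ ≤
      4 * Real.pi * a * (a * (Real.pi / 2 + 2 * sawSigma0 a β) + 2 * a * ‖sawS a β‖) / (a * Real.sqrt (max 0 (sawC2 a β))) *
        (((1 + 2 * Real.exp (-(2 * Real.pi * a) / 4) + 2 * Real.exp (-(2 * Real.pi * a) / 4) ^ 2 + 2 * Real.exp (-(2 * Real.pi * a) / 4) ^ 3 +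
            Real.exp (-(2 * Real.pi * a) / 4) ^ 4) * (Real.arsinh (ξ / a + θ) - Real.arsinh (ξ / a)) +
          (1 + 2 * Real.exp (-(2 * Real.pi * a) / 4) ^ 2 + Real.exp (-(2 * Real.pi * a) / 4) ^ 4) * (Real.arsinh (ξ / a) - Real.arsinh (ξ / a - θ))) /
          (((1 - Real.exp (-(2 * Real.pi * a))) * (2 * (2 * Real.pi * a))) * (2 * Real.pi * a))) := by
  have ha0 : 0 < a := by linarith
  have hω0 : 0 < a * Real.sqrt (max 0 (sawC2 a β)) := by have := omega_ge ha β; linarith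
  have hp := kh_p_nonneg ha β
  have hdiag := norm_blockX_diag_eq' ha0 h0
  rw [abs_of_nonneg hp] at hdiag
  have hωx : a * Real.sqrt (max 0 (sawC2 a β)) ≤ ‖(((2 * Real.pi * a : ℝ) : ℂ) * Complex.I) * ((1 / 4 : ℂ) + 2 * G0)‖ := by
    rw [hdiag, ← abs_of_nonneg hp]; exact omega_le_diag ha β
  have hD : (1 - Real.exp (-(2 * Real.pi * a))) * (2 * (2 * Real.pi * a)) ≠ 0 := by
    have hq1 : Real.exp (-(2 * Real.pi * a)) < 1 := Real.exp_lt_one_iff.2 (by nlinarith [Real.pi_pos])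
    have : 0 < 2 * (2 * Real.pi * a) := by positivity
    nlinarith
  have henv : Continuous fun s : ℝ => (1 + 2 * Real.exp (-(2 * Real.pi * a) / 4) + 2 * Real.exp (-(2 * Real.pi * a) / 4) ^ 2 +
        2 * Real.exp (-(2 * Real.pi * a) / 4) ^ 3 + Real.exp (-(2 * Real.pi * a) / 4) ^ 4) /
          (((1 - Real.exp (-(2 * Real.pi * a))) * (2 * (2 * Real.pi * a))) * ((2 * Real.pi * a) * Real.sqrt (1 + (ξ / a + 1 * s) ^ 2))) +
        (1 + 2 * Real.exp (-(2 * Real.pi * a) / 4) ^ 2 + Real.exp (-(2 * Real.pi * a) / 4) ^ 4) /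
          (((1 - Real.exp (-(2 * Real.pi * a))) * (2 * (2 * Real.pi * a))) * ((2 * Real.pi * a) * Real.sqrt (1 + (ξ / a + (-1) * s) ^ 2))) := by
    have h1 : ∀ s : ℝ, ((1 - Real.exp (-(2 * Real.pi * a))) * (2 * (2 * Real.pi * a))) * ((2 * Real.pi * a) * Real.sqrt (1 + (ξ / a + 1 * s) ^ 2)) ≠ 0 :=
      fun s => mul_ne_zero hD (mul_ne_zero (by positivity) (Real.sqrt_pos.2 (by positivity)).ne')
    have h2 : ∀ s : ℝ, ((1 - Real.exp (-(2 * Real.pi * a))) * (2 * (2 * Real.pi * a))) * ((2 * Real.pi * a) * Real.sqrt (1 + (ξ / a + (-1) * s) ^ 2)) ≠ 0 :=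
      fun s => mul_ne_zero hD (mul_ne_zero (by positivity) (Real.sqrt_pos.2 (by positivity)).ne')
    exact (Continuous.div continuous_const (by fun_prop) h1).add (Continuous.div continuous_const (by fun_prop) h2)
  have h := norm_duhamel_env_le' (c₀ := ((2 * Real.pi * a : ℝ) * Complex.I : ℂ) * (-2)) (c₁ := ((2 * Real.pi * a : ℝ) * Complex.I : ℂ) * 2)
    (x₀ := (((2 * Real.pi * a : ℝ) : ℂ) * Complex.I) * (2 * starRingEnd ℂ Gh)) hθ hω0 (blockX_diag_re' h0) hωx henv hE₀ hE₁
  rw [integral_mode_envelope] at h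
  have hκ : 0 < 2 * Real.pi * a := by positivity
  have hc0 : ‖(((2 * Real.pi * a : ℝ) * Complex.I : ℂ) * (-2))‖ = 4 * Real.pi * a := by
    rw [norm_mul, norm_mul, Complex.norm_real, Complex.norm_I, Real.norm_eq_abs, abs_of_pos hκ, norm_neg]; simp; ring
  have hc1 : ‖(((2 * Real.pi * a : ℝ) * Complex.I : ℂ) * 2)‖ = 4 * Real.pi * a := by
    rw [norm_mul, norm_mul, Complex.norm_real, Complex.norm_I, Real.norm_eq_abs, abs_of_pos hκ]; simp; ring
  rw [hc0, hc1, hdiag, norm_blockX_off_eq' ha0 hh] at h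
  refine h.trans (le_of_eq ?_)
  ring

/-! ## §4 The number: `≤ 0.889/a` for every mode (`a ≥ 4`, `0 ≤ θ ≤ 8`) -/

/-- The ξ-resolved envelope factor is at most the mode-`0` one: `N₊I₊ + N₋I₋ ≤ N₊·2·arsinh θ` (`N₋ ≤ N₊`, `I₊ + I₋ ≤ 2 arsinh θ`). [folklore] -/
theorem mode_envelope_factor_le (a ξ : ℝ) {θ : ℝ} (hθ : 0 ≤ θ) :
    (1 + 2 * Real.exp (-(2 * Real.pi * a) / 4) + 2 * Real.exp (-(2 * Real.pi * a) / 4) ^ 2 + 2 * Real.exp (-(2 * Real.pi * a) / 4) ^ 3 +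
          Real.exp (-(2 * Real.pi * a) / 4) ^ 4) * (Real.arsinh (ξ / a + θ) - Real.arsinh (ξ / a)) +
        (1 + 2 * Real.exp (-(2 * Real.pi * a) / 4) ^ 2 + Real.exp (-(2 * Real.pi * a) / 4) ^ 4) * (Real.arsinh (ξ / a) - Real.arsinh (ξ / a - θ)) ≤
      (1 + 2 * Real.exp (-(2 * Real.pi * a) / 4) + 2 * Real.exp (-(2 * Real.pi * a) / 4) ^ 2 + 2 * Real.exp (-(2 * Real.pi * a) / 4) ^ 3 +
          Real.exp (-(2 * Real.pi * a) / 4) ^ 4) * (2 * Real.arsinh θ) := by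
  set x := Real.exp (-(2 * Real.pi * a) / 4) with hx
  have hx0 : 0 ≤ x := (Real.exp_pos _).le
  set u := ξ / a
  have hIp : 0 ≤ Real.arsinh (u + θ) - Real.arsinh u := by
    have := Real.arsinh_le_arsinh.2 (show u ≤ u + θ by linarith); linarith
  have hIm : 0 ≤ Real.arsinh u - Real.arsinh (u - θ) := by
    have := Real.arsinh_le_arsinh.2 (show u - θ ≤ u by linarith); linarith
  have hW := arsinh_window_le hθ u
  have hNN : 1 + 2 * x ^ 2 + x ^ 4 ≤ 1 + 2 * x + 2 * x ^ 2 + 2 * x ^ 3 + x ^ 4 := by nlinarith [pow_nonneg hx0 3]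
  have hNp0 : 0 ≤ 1 + 2 * x + 2 * x ^ 2 + 2 * x ^ 3 + x ^ 4 := by positivity
  calc (1 + 2 * x + 2 * x ^ 2 + 2 * x ^ 3 + x ^ 4) * (Real.arsinh (u + θ) - Real.arsinh u) +
        (1 + 2 * x ^ 2 + x ^ 4) * (Real.arsinh u - Real.arsinh (u - θ))
      ≤ (1 + 2 * x + 2 * x ^ 2 + 2 * x ^ 3 + x ^ 4) * (Real.arsinh (u + θ) - Real.arsinh u) +
        (1 + 2 * x + 2 * x ^ 2 + 2 * x ^ 3 + x ^ 4) * (Real.arsinh u - Real.arsinh (u - θ)) := by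
          have := mul_le_mul_of_nonneg_right hNN hIm; linarith
    _ = (1 + 2 * x + 2 * x ^ 2 + 2 * x ^ 3 + x ^ 4) * (Real.arsinh (u + θ) - Real.arsinh (u - θ)) := by ring
    _ ≤ (1 + 2 * x + 2 * x ^ 2 + 2 * x ^ 3 + x ^ 4) * (2 * Real.arsinh θ) := mul_le_mul_of_nonneg_left hW hNp0

/-- **The numeric factor at `a ≥ 4`, `0 ≤ θ ≤ 8`, any mode:** `4πa(a·p+2a‖S‖)/ω · (N₊I₊ + N₋I₋)/((1−q)2κ·κ) ≤ 0.889/a`. [folklore] -/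
theorem mode_factor_le (ha : 4 ≤ a) (β ξ : ℝ) {θ : ℝ} (hθ0 : 0 ≤ θ) (hθ : θ ≤ 8) :
    4 * Real.pi * a * (a * (Real.pi / 2 + 2 * sawSigma0 a β) + 2 * a * ‖sawS a β‖) / (a * Real.sqrt (max 0 (sawC2 a β))) *
        (((1 + 2 * Real.exp (-(2 * Real.pi * a) / 4) + 2 * Real.exp (-(2 * Real.pi * a) / 4) ^ 2 + 2 * Real.exp (-(2 * Real.pi * a) / 4) ^ 3 +
            Real.exp (-(2 * Real.pi * a) / 4) ^ 4) * (Real.arsinh (ξ / a + θ) - Real.arsinh (ξ / a)) +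
          (1 + 2 * Real.exp (-(2 * Real.pi * a) / 4) ^ 2 + Real.exp (-(2 * Real.pi * a) / 4) ^ 4) * (Real.arsinh (ξ / a) - Real.arsinh (ξ / a - θ))) /
          (((1 - Real.exp (-(2 * Real.pi * a))) * (2 * (2 * Real.pi * a))) * (2 * Real.pi * a))) ≤ 0.889 / a := by
  have ha1 : 1 ≤ a := by linarith
  have ha0 : 0 < a := by linarith
  have hπ : (3.1415 : ℝ) < Real.pi := Real.pi_gt_d4
  have hR : (a * (Real.pi / 2 + 2 * sawSigma0 a β) + 2 * a * ‖sawS a β‖) / (a * Real.sqrt (max 0 (sawC2 a β))) ≤ 1.00002 :=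
    (comb_ratio_le ha1 β).trans (by linarith [comb_ratio_defect_le ha β])
  have hR0 : 0 ≤ (a * (Real.pi / 2 + 2 * sawSigma0 a β) + 2 * a * ‖sawS a β‖) / (a * Real.sqrt (max 0 (sawC2 a β))) := by
    have := kh_p_ge ha1 β; positivity
  have hx := exp_neg_quarter_kappa_le ha
  have hx0 : 0 ≤ Real.exp (-(2 * Real.pi * a) / 4) := (Real.exp_pos _).le
  have hq : Real.exp (-(2 * Real.pi * a)) ≤ (1 / 400) ^ 4 := exp_neg_kappa_le_pow ha
  have hq0 : 0 < Real.exp (-(2 * Real.pi * a)) := Real.exp_pos _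
  have hash : Real.arsinh θ ≤ 2.777 := (Real.arsinh_le_arsinh.2 hθ).trans arsinh_eight_le
  have hash0 : 0 ≤ Real.arsinh θ := Real.arsinh_nonneg_iff.2 hθ0
  have hF := mode_envelope_factor_le a ξ hθ0
  set x := Real.exp (-(2 * Real.pi * a) / 4) with hxdef
  set q := Real.exp (-(2 * Real.pi * a)) with hqdef
  set R := (a * (Real.pi / 2 + 2 * sawSigma0 a β) + 2 * a * ‖sawS a β‖) / (a * Real.sqrt (max 0 (sawC2 a β))) with hR_def
  set F := (1 + 2 * x + 2 * x ^ 2 + 2 * x ^ 3 + x ^ 4) * (Real.arsinh (ξ / a + θ) - Real.arsinh (ξ / a)) +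
    (1 + 2 * x ^ 2 + x ^ 4) * (Real.arsinh (ξ / a) - Real.arsinh (ξ / a - θ)) with hF_def
  have hNp : 1 + 2 * x + 2 * x ^ 2 + 2 * x ^ 3 + x ^ 4 ≤ 1.0050126 := by
    have h2 : x ^ 2 ≤ (1 / 400) ^ 2 := pow_le_pow_left₀ hx0 hx 2
    have h3 : x ^ 3 ≤ (1 / 400) ^ 3 := pow_le_pow_left₀ hx0 hx 3
    have h4 : x ^ 4 ≤ (1 / 400) ^ 4 := pow_le_pow_left₀ hx0 hx 4
    norm_num at h2 h3 h4 ⊢; linarith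
  have hF1 : F ≤ 1.0050126 * (2 * 2.777) := by
    refine hF.trans ?_
    exact mul_le_mul hNp (by linarith) (by positivity) (by norm_num)
  have hF0 : 0 ≤ F := by
    rw [hF_def]
    have hIp : 0 ≤ Real.arsinh (ξ / a + θ) - Real.arsinh (ξ / a) := by
      have := Real.arsinh_le_arsinh.2 (show ξ / a ≤ ξ / a + θ by linarith); linarith
    have hIm : 0 ≤ Real.arsinh (ξ / a) - Real.arsinh (ξ / a - θ) := by
      have := Real.arsinh_le_arsinh.2 (show ξ / a - θ ≤ ξ / a by linarith); linarith
    positivity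
  have h1q : 0 < 1 - q := by norm_num at hq; linarith
  have e : 4 * Real.pi * a * (a * (Real.pi / 2 + 2 * sawSigma0 a β) + 2 * a * ‖sawS a β‖) / (a * Real.sqrt (max 0 (sawC2 a β))) *
        (F / (((1 - q) * (2 * (2 * Real.pi * a))) * (2 * Real.pi * a))) = (R * (F / (1 - q))) / (2 * Real.pi * a) := by
    rw [hR_def]; field_simp; ring
  rw [e, div_le_div_iff₀ (by positivity) ha0]
  have hFq : F / (1 - q) ≤ 1.0050127 * (2 * 2.777) := by
    rw [div_le_iff₀ h1q]; norm_num at hq ⊢; nlinarith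
  have hFq0 : 0 ≤ F / (1 - q) := by positivity
  have h3 : R * (F / (1 - q)) ≤ 1.00002 * (1.0050127 * (2 * 2.777)) := mul_le_mul hR hFq hFq0 (by norm_num)
  nlinarith

/-- **THE SHARP SINGLE-MODE CREATION LAW, component `0`:** for `a ≥ 4`, `0 ≤ θ ≤ 8`, any Bloch phase `β` and ANY mode `ξ`, the created amplitude is
`≤ 0.889/a` (sources with the two-envelope bounds of `…KHModeSource`). [cite: Drazin2002, §8.3 (8.36)–(8.38)] -/
theorem mode_creation_num_le (ha : 4 ≤ a) (hθ0 : 0 ≤ θ) (hθ : θ ≤ 8) (h0 : (2 * Real.pi : ℂ) * G0 = ((sawSigma0 a β : ℝ) : ℂ))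
    (hh : (2 * Real.pi : ℂ) * starRingEnd ℂ Gh = sawS a β)
    (hE₀ : ∀ s, ‖S₀ s‖ ≤ (1 + 2 * Real.exp (-(2 * Real.pi * a) / 4) + 2 * Real.exp (-(2 * Real.pi * a) / 4) ^ 2 +
        2 * Real.exp (-(2 * Real.pi * a) / 4) ^ 3 + Real.exp (-(2 * Real.pi * a) / 4) ^ 4) /
          (((1 - Real.exp (-(2 * Real.pi * a))) * (2 * (2 * Real.pi * a))) * ((2 * Real.pi * a) * Real.sqrt (1 + (ξ / a + 1 * s) ^ 2))) +
        (1 + 2 * Real.exp (-(2 * Real.pi * a) / 4) ^ 2 + Real.exp (-(2 * Real.pi * a) / 4) ^ 4) /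
          (((1 - Real.exp (-(2 * Real.pi * a))) * (2 * (2 * Real.pi * a))) * ((2 * Real.pi * a) * Real.sqrt (1 + (ξ / a + (-1) * s) ^ 2))))
    (hE₁ : ∀ s, ‖S₁ s‖ ≤ (1 + 2 * Real.exp (-(2 * Real.pi * a) / 4) + 2 * Real.exp (-(2 * Real.pi * a) / 4) ^ 2 +
        2 * Real.exp (-(2 * Real.pi * a) / 4) ^ 3 + Real.exp (-(2 * Real.pi * a) / 4) ^ 4) /
          (((1 - Real.exp (-(2 * Real.pi * a))) * (2 * (2 * Real.pi * a))) * ((2 * Real.pi * a) * Real.sqrt (1 + (ξ / a + 1 * s) ^ 2))) +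
        (1 + 2 * Real.exp (-(2 * Real.pi * a) / 4) ^ 2 + Real.exp (-(2 * Real.pi * a) / 4) ^ 4) /
          (((1 - Real.exp (-(2 * Real.pi * a))) * (2 * (2 * Real.pi * a))) * ((2 * Real.pi * a) * Real.sqrt (1 + (ξ / a + (-1) * s) ^ 2)))) :
    ‖∫ s in (0 : ℝ)..θ, ((Real.cos (a * Real.sqrt (max 0 (sawC2 a β)) * (θ - s)) : ℂ) *
          ((((2 * Real.pi * a : ℝ) * Complex.I : ℂ) * (-2)) * S₀ s) +
        ((Real.sin (a * Real.sqrt (max 0 (sawC2 a β)) * (θ - s)) / (a * Real.sqrt (max 0 (sawC2 a β))) : ℝ) : ℂ) *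
          ((((2 * Real.pi * a : ℝ) : ℂ) * Complex.I) * (-(1 / 4 : ℂ) - 2 * G0) * ((((2 * Real.pi * a : ℝ) * Complex.I : ℂ) * (-2)) * S₀ s) +
            (((2 * Real.pi * a : ℝ) : ℂ) * Complex.I) * (-2 * Gh) * ((((2 * Real.pi * a : ℝ) * Complex.I : ℂ) * 2) * S₁ s)))‖ ≤
      0.889 / a :=
  (mode_component_le (by linarith) hθ0 h0 hh hE₀ hE₁).trans (mode_factor_le ha β ξ hθ0 hθ)

/-- **THE SHARP SINGLE-MODE CREATION LAW, component `1`:** `≤ 0.889/a`. [cite: Drazin2002, §8.3 (8.36)–(8.38)] -/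
theorem mode_creation_num_le' (ha : 4 ≤ a) (hθ0 : 0 ≤ θ) (hθ : θ ≤ 8) (h0 : (2 * Real.pi : ℂ) * G0 = ((sawSigma0 a β : ℝ) : ℂ))
    (hh : (2 * Real.pi : ℂ) * starRingEnd ℂ Gh = sawS a β)
    (hE₀ : ∀ s, ‖S₀ s‖ ≤ (1 + 2 * Real.exp (-(2 * Real.pi * a) / 4) + 2 * Real.exp (-(2 * Real.pi * a) / 4) ^ 2 +
        2 * Real.exp (-(2 * Real.pi * a) / 4) ^ 3 + Real.exp (-(2 * Real.pi * a) / 4) ^ 4) /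
          (((1 - Real.exp (-(2 * Real.pi * a))) * (2 * (2 * Real.pi * a))) * ((2 * Real.pi * a) * Real.sqrt (1 + (ξ / a + 1 * s) ^ 2))) +
        (1 + 2 * Real.exp (-(2 * Real.pi * a) / 4) ^ 2 + Real.exp (-(2 * Real.pi * a) / 4) ^ 4) /
          (((1 - Real.exp (-(2 * Real.pi * a))) * (2 * (2 * Real.pi * a))) * ((2 * Real.pi * a) * Real.sqrt (1 + (ξ / a + (-1) * s) ^ 2))))
    (hE₁ : ∀ s, ‖S₁ s‖ ≤ (1 + 2 * Real.exp (-(2 * Real.pi * a) / 4) + 2 * Real.exp (-(2 * Real.pi * a) / 4) ^ 2 +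
        2 * Real.exp (-(2 * Real.pi * a) / 4) ^ 3 + Real.exp (-(2 * Real.pi * a) / 4) ^ 4) /
          (((1 - Real.exp (-(2 * Real.pi * a))) * (2 * (2 * Real.pi * a))) * ((2 * Real.pi * a) * Real.sqrt (1 + (ξ / a + 1 * s) ^ 2))) +
        (1 + 2 * Real.exp (-(2 * Real.pi * a) / 4) ^ 2 + Real.exp (-(2 * Real.pi * a) / 4) ^ 4) /
          (((1 - Real.exp (-(2 * Real.pi * a))) * (2 * (2 * Real.pi * a))) * ((2 * Real.pi * a) * Real.sqrt (1 + (ξ / a + (-1) * s) ^ 2)))) :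
    ‖∫ s in (0 : ℝ)..θ, ((Real.cos (a * Real.sqrt (max 0 (sawC2 a β)) * (θ - s)) : ℂ) *
          ((((2 * Real.pi * a : ℝ) * Complex.I : ℂ) * 2) * S₁ s) +
        ((Real.sin (a * Real.sqrt (max 0 (sawC2 a β)) * (θ - s)) / (a * Real.sqrt (max 0 (sawC2 a β))) : ℝ) : ℂ) *
          ((((2 * Real.pi * a : ℝ) : ℂ) * Complex.I) * (2 * starRingEnd ℂ Gh) * ((((2 * Real.pi * a : ℝ) * Complex.I : ℂ) * (-2)) * S₀ s) +
            (((2 * Real.pi * a : ℝ) : ℂ) * Complex.I) * ((1 / 4 : ℂ) + 2 * G0) * ((((2 * Real.pi * a : ℝ) * Complex.I : ℂ) * 2) * S₁ s)))‖ ≤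
      0.889 / a :=
  (mode_component_le' (by linarith) hθ0 h0 hh hE₀ hE₁).trans (mode_factor_le ha β ξ hθ0 hθ)

end mode

end Summit.AnomalousDissipation.AnomalousDissipation.Theorems.SawtoothPulseCascade.K2PhaseBudget

end
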